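import Literature.NumberTheory.EllipticCurves.BurungaleCastellaGrossiSkinner2026.RefinedKolyvaginConjecture
import Literature.NumberTheory.EllipticCurves.HeegnerPointsKolyvaginTorsionProofs
import Literature.NumberTheory.EllipticCurves.HeegnerPointsKolyvaginPrimitivity
import Literature.NumberTheory.EllipticCurves.HeegnerPointsKolyvaginModPRigidity
import Literature.NumberTheory.EllipticCurves.Jetchev2008.CoreVertices
import HarnessLib
import Literature.NumberTheory.EllipticCurves.HeegnerPointsKolyvaginDivisibilityIndexManin

/-!
# Route `KolyvaginDepthDoor`, crux `KolyvaginDepthSupplyKN` (stmt-BirchSwinnertonDyer-22820) —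
# THE MOD-`p` STRUCTURE STATEMENT ON A FRAME WITH `p ∤ c_φ` (Manin constant) INSTEAD OF A `p`-OPTIMAL
# FRAME: Castella–Sano 2026 Thm. 3 (refined Kolyvagin conjecture, `p` split) ∘ Zanarella 2019 ∘
# Howard–Zanarella rigidity

Helper file of the lead prover of line `levelone` (kdd-p1 g13; `--supports stmt-BirchSwinnertonDyer-22820
--as helper`); route-free (Literature imports only); it closes nothing and BSD is not proved by it.

Skeleton v8's only non-open, non-print stub is `stub_pOptimalFrame` — the bookkeeping input of the
Burungale–Castella–Grossi–Skinner record (`Dt.IsPOptimal p`: `ord_p(deg Dt)` minimal in the class),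
which the tree cannot produce (it records the optimal datum's minimality as an inequality of degrees).
Castella–Sano 2026 (arXiv:2601.14504), Theorem 3, proves W. Zhang's refined Kolyvagin conjecture
`𝓜_∞(κ^Heeg) = ord_p(Tam_E)` — for `p` split in `K` — with the `p`-optimality hypothesis REPLACED by
(manin) `p ∤ c_φ`, the Manin constant of the FIXED parametrisation, and with `𝓜(n)` measured inside
Howard's modified Selmer module `H¹_{𝓕(n)}(K, T/I_nT)` (tree: `Jetchev2008.modifiedSelmerGroup`). A
frame with `p ∤ c` is tree-available modulo print (Mazur 1978 + the Néron mapping property: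
`Rank1Residual/X11b/BDPRouteManin.exists_modularParametrizationData_not_dvd`). Two named facts are
stated INLINE below for relocation by the gate:

* `CastellaSano2026_kolyvaginClass_selmerDivisibility_eq_padicValNat_tamagawaProduct` — Thm. 3,
  split case, in the `(≥) ∧ (≤)` divisibility-pair shape of the BCGS Thm. 2 record, divisibility taken
  in `H¹_{𝓕(n)}(K, E[p^{M(n)}])`;
* `Zanarella2019_kolyvaginClass_one_ne_zero_of_not_selmerDivisible` — Zanarella Prop. 2.18 with the
  non-divisibility hypothesis in the SELMER MODULE `H^{(k)}(n) = H¹_{𝓕(n)}(K, T/𝔪^kT)` of his Def. 2.17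
  (the tree's earlier record `Zanarella2019_kolyvaginClass_one_ne_zero_of_not_divisible`, p669363,
  asks non-divisibility in the full `H¹`, a stronger hypothesis);

and two theorems are PROVED from them and the Howard–Zanarella rigidity fact (p675362):
`exists_kolyvaginClass_one_ne_zero_of_castellaSano` (the mod-`p` system is non-zero on a frame with
`p ∤ c`, `p` split, `p ∤ Tam_E`) and `exists_minimal_kolyvaginClass_one_selmerCard_of_castellaSano` (+
minimal depth and W. Zhang's Lemma 8.4 (1) dichotomy). CONDITIONAL on the named facts; BSD is NOT
proved by this.

References: [CastellaSano2026] F. Castella, T. Sano, *On refined nonvanishing conjectures by Kurihara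
and Kolyvagin*, arXiv:2601.14504 (2026) (held `paper:arxiv-2601.14504`): §1.1.1 (sur), §1.1.2 `Tam_E`,
§1.1.5 (Heeg)/(disc)/(manin)/`𝓛_Heeg`/`I_ℓ`/`κ_n^Heeg`/`𝓜(n)`/`𝓜_r`/`𝓜_∞`, Conj. 3, Thm. 3 (§1.1.6),
§3.1 (ord)/(unr)/`𝓕(n)`, §3.4; [Zanarella2019] Def. 2.17, Prop. 2.18, §3.1; [Howard2004] Def. 1.2.2,
Thm. 1.7.3/1.7.5; [Jetchev2008] §3.1.2, §3.4.1 (the modified Selmer module); [BurungaleEtAl2026] Thm. 2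
(the `p`-optimal twin); [Mazur1978] Cor. 4.1; [GrossLMS1991] §3–§4.
-/

-- D-0017: single-problem summit, `Summit.BirchSwinnertonDyer.BirchSwinnertonDyer.…` repeats a namespace BY DESIGN.
set_option linter.dupNamespace false

noncomputable section

open scoped Classical

namespace Summit.BirchSwinnertonDyer.BirchSwinnertonDyer.Theorems.KolyvaginDepthDoor

open Literature.NumberTheory.EllipticCurves Literature.NumberTheory.EllipticCurves.ModularForms WeierstrassCurve

/-- **Kolyvagin's conjecture MOD `p` on a frame with `p ∤ c_φ`, `p` split, `p ∤ Tam_E` (modulo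
Castella–Sano 2026 Thm. 3 and Zanarella 2019 Prop. 2.18, Selmer-module form).** For `E/ℚ` globally
minimal, `p ≥ 5` good ordinary with `ρ̄_{E,p}` onto and `p ∤ Tam_E`, `K` imaginary quadratic Heegner
with `d_K` odd, `d_K ≠ −3, −4`, `(d_K, N_E) = 1`, `p ∤ d_K`, `p` split in `K`, and a frame
`(Dt, β, ι)` with `p ∤ Dt.c`: some `c_1(n) ≠ 0`, `n ∈ Λ`. Proof: `E(K)[p] = 0` (`ρ̄` onto), Thm. 3's
(≤) half at `t = ord_p(Tam_E) = 0` gives a class not `p`-divisible in its Selmer module, Zanarella's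
bridge gives the level-one class. CONDITIONAL on the two named facts.
[cite: CastellaSano2026, Thm. 3 (arXiv:2601.14504 §1.1.6)] [cite: Zanarella2019, Def. 2.17, Prop. 2.18] -/
theorem exists_kolyvaginClass_one_ne_zero_of_castellaSano
    (h3 : Literature.NumberTheory.EllipticCurves.CastellaSano2026_kolyvaginClass_selmerDivisibility_eq_padicValNat_tamagawaProduct)
    (hZ : Literature.NumberTheory.EllipticCurves.Zanarella2019_kolyvaginClass_one_ne_zero_of_not_selmerDivisible)
    (W : WeierstrassCurve ℚ) [W.IsElliptic] [W.IsGloballyMinimal] (p : ℕ) [hp : Fact p.Prime]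
    (h5 : 5 ≤ p) (hgood : W.HasGoodReductionAtPrime p) (hord : ¬ (p : ℤ) ∣ W.frobeniusTrace p)
    (hsur : W.HasSurjectiveModNGaloisRep p) (htam : ¬ p ∣ W.tamagawaProduct)
    (K : Type) [Field K] [NumberField K] (hK : IsImaginaryQuadratic K)
    [NeZero (W.conductorNorm ℤ)] (hHeeg : SatisfiesHeegnerHypothesis (W.conductorNorm ℤ) K)
    (hodd : Odd (NumberField.discr K)) (hD3 : NumberField.discr K ≠ -3) (hD4 : NumberField.discr K ≠ -4)
    (hDN : IsCoprime (NumberField.discr K) ((W.conductorNorm ℤ : ℕ) : ℤ))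
    (hpD : ¬ ((p : ℤ) ∣ NumberField.discr K)) (hspl : SatisfiesHeegnerHypothesis p K)
    (Dt : ModularParametrizationData W (W.conductorNorm ℤ)) (hc : ¬ ((p : ℤ) ∣ Dt.c))
    (β : ℤ) (hβ : (4 * (W.conductorNorm ℤ : ℤ)) ∣ β ^ 2 - NumberField.discr K) (ι : K →+* ℂ)
    [∀ k : ℕ, NumberField (ringClassField K ι k)] :
    ∃ (n : ℕ) (d : KolyvaginHeegnerData Dt β ι n),
      KolyvaginDescent.KolSupp (Zhang2014.IsKolyvaginPrime (W.conductorNorm ℤ) W K p) n ∧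
        d.kolyvaginClass hp.out 1 ≠ 0 := by
  have hpP : p.Prime := hp.out
  have h3p : 3 < p := by omega
  have hlt : NumberField.discr K < -4 := by
    have hgt : 2 < |NumberField.discr K| :=
      NumberField.abs_discr_gt_two (by rw [hK.1]; exact one_lt_two)
    rw [abs_of_neg hK.discr_neg] at hgt
    obtain ⟨r, hr⟩ := hodd
    omega
  have htor : AddSubgroup.torsionBy (W.baseChange K).toAffine.Point (p : ℤ) = ⊥ :=
    torsionBy_eq_bot_of_isImaginaryQuadratic W K hK hpP (by omega) hsur
  obtain ⟨-, n, d, M, hn1, hsupp, hM, hndiv⟩ :=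
    h3 W p h3p hgood hord hsur K hK hHeeg hodd hD3 hpD htor hspl Dt hc β hβ ι
  have ht : padicValNat p W.tamagawaProduct = 0 := padicValNat.eq_zero_of_not_dvd htam
  rw [ht, zero_add, pow_one] at hndiv
  exact hZ W p h5 hgood hord hsur K hK hlt hpD hDN hHeeg Dt β ι n d M hn1 hsupp hM hndiv

/-- **The mod-`p` structure statement on a frame with `p ∤ c_φ` (minimal-depth form; modulo
Castella–Sano Thm. 3, Zanarella Prop. 2.18 (Selmer form) and the Howard–Zanarella rigidity fact).**
Under the hypotheses of `exists_kolyvaginClass_one_ne_zero_of_castellaSano` together with the tower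
`ρ_{E,p^n}` onto: `n ∈ Λ` and a datum with `c_1(n) ≠ 0` of MINIMAL depth, and `#Sel_p(E/ℚ) =
p^{ν(n)+1} ∧ #Sel_p(E^{(d_K)}/ℚ) ≤ p^{ν(n)}` or the mirror statement — W. Zhang's Lemma 8.4 (1) shape,
NO Hypothesis ♠, NO `p`-optimality. CONDITIONAL on the three named facts; BSD is not proved by it.
[cite: CastellaSano2026, Thm. 3] [cite: Zanarella2019, Prop. 2.18, Cor. 2.12, Cor. 2.14, Prop. 2.15]
[cite: Howard2004, Thm. 1.4.2, Prop. 1.5.5, Lemma 1.6.4] [cite: WZhang2014, Lemma 8.4 (1) (p. 236)] -/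
theorem exists_minimal_kolyvaginClass_one_selmerCard_of_castellaSano
    (h3 : Literature.NumberTheory.EllipticCurves.CastellaSano2026_kolyvaginClass_selmerDivisibility_eq_padicValNat_tamagawaProduct)
    (hZ : Literature.NumberTheory.EllipticCurves.Zanarella2019_kolyvaginClass_one_ne_zero_of_not_selmerDivisible)
    (hHZ : Literature.NumberTheory.EllipticCurves.HowardZanarella_exists_minimal_kolyvaginClass_one_selmerCard_of_ne_zero)
    (W : WeierstrassCurve ℚ) [W.IsElliptic] [W.IsGloballyMinimal] (p : ℕ) [hp : Fact p.Prime]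
    (h5 : 5 ≤ p) (hgood : W.HasGoodReductionAtPrime p) (hord : ¬ (p : ℤ) ∣ W.frobeniusTrace p)
    (hsur : W.HasSurjectiveModNGaloisRep p) (htower : ∀ n : ℕ, W.HasSurjectiveModNGaloisRep (p ^ n : ℕ))
    (htam : ¬ p ∣ W.tamagawaProduct)
    (K : Type) [Field K] [NumberField K] (hK : IsImaginaryQuadratic K)
    [NeZero (W.conductorNorm ℤ)] (hHeeg : SatisfiesHeegnerHypothesis (W.conductorNorm ℤ) K)
    (hodd : Odd (NumberField.discr K)) (hD3 : NumberField.discr K ≠ -3) (hD4 : NumberField.discr K ≠ -4)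
    (hDN : IsCoprime (NumberField.discr K) ((W.conductorNorm ℤ : ℕ) : ℤ))
    (hpD : ¬ ((p : ℤ) ∣ NumberField.discr K)) (hspl : SatisfiesHeegnerHypothesis p K)
    (Dt : ModularParametrizationData W (W.conductorNorm ℤ)) (hc : ¬ ((p : ℤ) ∣ Dt.c))
    (β : ℤ) (hβ : (4 * (W.conductorNorm ℤ : ℤ)) ∣ β ^ 2 - NumberField.discr K) (ι : K →+* ℂ)
    [∀ k : ℕ, NumberField (ringClassField K ι k)] :
    ∃ (n : ℕ) (d : KolyvaginHeegnerData Dt β ι n),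
      KolyvaginDescent.KolSupp (Zhang2014.IsKolyvaginPrime (W.conductorNorm ℤ) W K p) n ∧
        d.kolyvaginClass hp.out 1 ≠ 0 ∧
        (∀ (n' : ℕ) (d' : KolyvaginHeegnerData Dt β ι n'),
          KolyvaginDescent.KolSupp (Zhang2014.IsKolyvaginPrime (W.conductorNorm ℤ) W K p) n' →
          d'.kolyvaginClass hp.out 1 ≠ 0 → n.primeFactors.card ≤ n'.primeFactors.card) ∧
        ((Nat.card (W.selmerGroup p) = p ^ (n.primeFactors.card + 1) ∧
            Nat.card ((W.quadraticTwist (NumberField.discr K : ℚ)).selmerGroup p) ≤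
              p ^ n.primeFactors.card) ∨
          (Nat.card ((W.quadraticTwist (NumberField.discr K : ℚ)).selmerGroup p) =
              p ^ (n.primeFactors.card + 1) ∧
            Nat.card (W.selmerGroup p) ≤ p ^ n.primeFactors.card)) :=
  hHZ W p h5 hgood hsur htower K hK hD3 hD4 hpD hDN hHeeg Dt β ι
    (exists_kolyvaginClass_one_ne_zero_of_castellaSano h3 hZ W p h5 hgood hord hsur htam K hK hHeeg
      hodd hD3 hD4 hDN hpD hspl Dt hc β hβ ι)

end Summit.BirchSwinnertonDyer.BirchSwinnertonDyer.Theorems.KolyvaginDepthDoor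

end
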